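import Summits.HubbardSuperconductivity.HubbardSuperconductivity.Theorems.CooperPairDMottWalkCooperPairDMottPairTrialCeilingCore
import Literature.MathematicalPhysics.QuantumLattice.HubbardLiebTwoHoppingsSector

/-!
# Route `CooperPairDMottWalk`, crux `CooperPairDMott` (stmt-HubbardSuperconductivity-1177):
# stub D′b `stub_dWaveResidueStructural` — the diagonal Gram bound of the dressed parent

Support file for the registered line `Cruxes/CooperPairDMott/Lines/birth.lean` (stub D′b, the structural
part of clause (c): a macroscopic `d_{x²−y²}` amplitude between the parent and the two-hole ground states
of the breathing torus `H_L(1, b, U)`). The main term of `⟨φ₂, Δ_d Ω⟩` is carried by the local pair-removal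
operators `A_c = (f_c)_*|π⟩⟨σ|` of the `(L/2)²` plaquettes (`σ`, `π` the unit `(4,0)` and `(2,0)` ground
states of one plaquette `h = hubbardTorus 2 2 1 U`, `f_c` the block embeddings); its size is controlled by
the DIAGONAL GRAM SUM `Σ_c ‖A_c Ω‖² = Σ_c Re⟨Ω, (f_c)_*|σ⟩⟨σ| Ω⟩`, the number of plaquettes of the dressed
parent `Ω` found in their singlet ground state. This file proves, uniformly in the volume,
`Σ_c Re⟨Ω, (f_c)_*|σ⟩⟨σ| Ω⟩ ≥ (L²/4 − 16 b L²/γ) ‖Ω‖²` for every ground state `Ω` of the parent sector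
(`sum_re_localVacuum_ge`; the GC-defect averaging of the pair ceiling, file `…PairTrialCeilingCore`,
summed over the plaquettes instead of pigeonholed: block decomposition, block product vector for
`E(L²,0) ≤ (L/2)² e₄ + 8bL²`, transport of the local defect form, `Σ_c Q_c = H_in − μN − (L/2)²(e₄ − 4μ)`),
from the RANK-ONE defect form of the plaquette `γ(‖v‖² − Re⟨v, |σ⟩⟨σ| v⟩) ≤ Re⟨v, (h − μN)v⟩ − (e₄ − 4μ)‖v‖²`
(`plaquette_rankOne_defect`), which is the grand-canonical window hypothesis GCW of the line combined with
the uniqueness of the `(4, 0)` plaquette ground state — Lieb's second theorem on the 4-cycle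
(`plaquette_halfFilled_groundStates_smul`, through the tree's two-hopping version with an empty second
bond graph).

References: E. H. Lieb, PRL 62 (1989) 1201, Theorem 2 [LiebPRL1989]; H. Tasaki (2020) App. A.2;
W.-F. Tsai, S. A. Kivelson, PRB 73 (2006) 214510. All statements are [folklore]; no definition is
introduced.
-/

set_option linter.dupNamespace false

noncomputable section

namespace Summit.HubbardSuperconductivity.HubbardSuperconductivity.Theorems.CooperPairDMottWalk

open Matrix Finset Literature.MathematicalPhysics.QuantumLattice Literature.Probability.LatticeModels
open Literature.MathematicalPhysics.QuantumLattice.ThermodynamicLimit (norm_toLp_sq norm_toLp_mulVec_le star_dotProduct_self_eq_re star_dotProduct_eq_inner)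
open scoped ComplexOrder Matrix.Norms.L2Operator

/-! ### The plaquette: the half-filled ground state is unique (Lieb); the rank-one defect form -/

/-- A Hubbard "Hamiltonian" on the empty graph with no interaction vanishes. [folklore] -/
theorem hamiltonian_bot_zero {Λ : Type*} [LinearOrder Λ] [Fintype Λ] (t : ℝ) :
    hamiltonian (⊥ : SimpleGraph Λ) t 0 = 0 := by
  simp [hamiltonian]

/-- **The `(4, 0)` ground state of the plaquette is unique up to a scalar** (`U > 0`): Lieb's second
theorem on the 4-cycle (connected, bipartite with two sites per colour class), through the tree's
two-hopping version with an empty second bond graph. [cite: LiebPRL1989, Theorem 2] -/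
theorem plaquette_halfFilled_groundStates_smul {U : ℝ} (hU : 0 < U) (φ φ' : Fock (Orb (FermionTorus 2 2)))
    (hφ : IsGroundStateInSector (hubbardTorus 2 2 1 U) 4 0 φ)
    (hφ' : IsGroundStateInSector (hubbardTorus 2 2 1 U) 4 0 φ') : ∃ c : ℂ, φ' = c • φ := by
  have hH : hubbardTorus 2 2 1 U =
      hamiltonian plaquetteGraph 1 U + hamiltonian (⊥ : SimpleGraph (FermionTorus 2 2)) 1 0 := by
    rw [hamiltonian_bot_zero, add_zero]; rfl
  have h4 : (4 : ℕ) = 2 * 2 := by norm_num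
  rw [hH, h4] at hφ hφ'
  have hG : (plaquetteGraph ⊔ (⊥ : SimpleGraph (FermionTorus 2 2))).Connected := by
    rw [sup_bot_eq]
    exact LiebTwoHoppings.fermionTorusGraph_connected 2 2
  have hXY : ∀ x y, plaquetteGraph.Adj x y → ¬ (⊥ : SimpleGraph (FermionTorus 2 2)).Adj x y :=
    fun _ _ _ h => h
  set A : Finset (FermionTorus 2 2) := univ.filter fun x : FermionTorus 2 2 => torusStagger x = 1 with hA
  have hmemA : ∀ x, x ∈ A ↔ torusStagger x = 1 := fun x => by
    rw [hA, mem_filter]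
    exact ⟨fun h => h.2, fun h => ⟨mem_univ _, h⟩⟩
  have hAX : ∀ x y : FermionTorus 2 2, plaquetteGraph.Adj x y → (x ∈ A ↔ y ∉ A) := by
    intro x y hxy
    have h := torusStagger_eq_neg_of_adj_holds (d := 2) (L := 2) ⟨1, rfl⟩ hxy
    rw [hmemA, hmemA, h]
    change -torusStagger y = 1 ↔ torusStagger y ≠ 1
    rw [Int.units_ne_iff_eq_neg, neg_eq_iff_eq_neg]
  have hAY : ∀ x y : FermionTorus 2 2, (⊥ : SimpleGraph (FermionTorus 2 2)).Adj x y → (x ∈ A ↔ y ∉ A) :=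
    fun _ _ h => absurd h id
  have hcard : Fintype.card (FermionTorus 2 2) = 2 * 2 := card_plaquetteSite
  have hAc : A.card + 0 = 2 := by
    have h := LiebTwoHoppings.two_mul_card_filter_torusStagger_eq_one (L := 2) ⟨1, rfl⟩
    rw [← hA] at h
    omega
  exact LiebTwoHoppings.szSector_groundStates_smul₂ _ _ hG hXY A hAX hAY hcard hAc one_ne_zero one_ne_zero
    hU φ φ' hφ hφ'

/-- **The rank-one defect form of the plaquette.** If the `(4,0)` ground space of
`h = hubbardTorus 2 2 1 U` (`U > 0`, so that it is the ray of a unit ground state `σ`) is the gapped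
grand-canonical ground space at chemical potential `μ` with gap `γ` — `(e₄ − 4μ + γ)‖v‖² ≤ Re⟨v, (h − μN)v⟩`
for `v ⊥` the ground space — then `γ(‖v‖² − Re⟨v, |σ⟩⟨σ| v⟩) ≤ Re⟨v, (h − μN)v⟩ − (e₄ − 4μ)‖v‖²` for
all `v`. [folklore] -/
theorem plaquette_rankOne_defect {U : ℝ} (hU : 0 < U) {μ γ : ℝ}
    (hgap : ∀ v : Fock (Orb (FermionTorus 2 2)),
        (∀ w ∈ szSector (Λ := FermionTorus 2 2) 4 0,
          hubbardTorus 2 2 1 U *ᵥ w = (((hubbardTorus 2 2 1 U).minEnergyOn (szSector 4 0) : ℝ) : ℂ) • w →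
            star w ⬝ᵥ v = 0) →
        ((hubbardTorus 2 2 1 U).minEnergyOn (szSector 4 0) - 4 * μ + γ) * (star v ⬝ᵥ v).re ≤
          (star v ⬝ᵥ ((hubbardTorus 2 2 1 U - (μ : ℂ) • totalNumber) *ᵥ v)).re)
    {σ : Fock (Orb (FermionTorus 2 2))} (hσ1 : star σ ⬝ᵥ σ = 1)
    (hσ : IsGroundStateInSector (hubbardTorus 2 2 1 U) 4 0 σ) (v : Fock (Orb (FermionTorus 2 2))) :
    γ * ((star v ⬝ᵥ v).re - (star v ⬝ᵥ (vecMulVec σ (star σ) *ᵥ v)).re) ≤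
      (star v ⬝ᵥ ((hubbardTorus 2 2 1 U - (μ : ℂ) • totalNumber) *ᵥ v)).re -
        ((hubbardTorus 2 2 1 U).minEnergyOn (szSector 4 0) - 4 * μ) * (star v ⬝ᵥ v).re := by
  set h := hubbardTorus 2 2 1 U with hh_def
  set e₄ : ℝ := h.minEnergyOn (szSector 4 0) with he₄
  set W : Submodule ℂ (Fock (Orb (FermionTorus 2 2))) :=
    szSector 4 0 ⊓ Module.End.eigenspace (Matrix.toLin' h) (e₄ : ℂ) with hW
  have hmemW : ∀ w, w ∈ W ↔ w ∈ szSector (Λ := FermionTorus 2 2) 4 0 ∧ h *ᵥ w = (e₄ : ℂ) • w := by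
    intro w
    rw [hW, Submodule.mem_inf, Module.End.mem_eigenspace_iff, Matrix.toLin'_apply]
  -- every vector of `W` is a multiple of `σ`
  have hWσ : ∀ w ∈ W, ∃ c : ℂ, w = c • σ := by
    intro w hw
    by_cases hw0 : w = 0
    · exact ⟨0, by rw [hw0, zero_smul]⟩
    · obtain ⟨hwS, hwE⟩ := (hmemW w).1 hw
      exact plaquette_halfFilled_groundStates_smul hU σ w hσ ⟨hwS, hw0, hwE⟩
  set B : Matrix (Finset (Orb (FermionTorus 2 2))) (Fin 1) ℂ := Matrix.of fun x _ => σ x with hB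
  have hBB : B * Bᴴ = vecMulVec σ (star σ) := by
    ext x y
    simp [hB, Matrix.mul_apply, vecMulVec_apply]
  have hcol : ∀ j, (fun x => B x j) ∈ W := fun j => (hmemW _).2 ⟨hσ.1, hσ.2.2⟩
  have hfix : ∀ w ∈ W, (B * Bᴴ) *ᵥ w = w := by
    intro w hw
    obtain ⟨c, rfl⟩ := hWσ w hw
    rw [hBB, mulVec_smul, vecMulVec_self_mulVec, hσ1, one_smul]
  have hq : (h - (μ : ℂ) • totalNumber).IsHermitian := by
    have := isHermitian_hamiltonianWith plaquetteGraph 1 U μ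
    rwa [hamiltonianWith_eq] at this
  have hWq : ∀ w ∈ W, (h - (μ : ℂ) • totalNumber) *ᵥ w = ((e₄ - 4 * μ : ℝ) : ℂ) • w := by
    intro w hw
    obtain ⟨hwS, hw4⟩ := (hmemW w).1 hw
    have hN : totalNumber *ᵥ w = ((4 : ℕ) : ℂ) • w :=
      (LiebTwo.isNParticle_iff_totalNumber 4 w).1 ((mem_szSector_iff 4 0 w).1 hwS).1
    rw [sub_mulVec, smul_mulVec, hw4, hN, smul_smul, ← sub_smul]
    congr 1
    push_cast
    ring
  have hdef := re_form_defect_le_of_gap hq W hWq (fun v hv => by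
    have := hgap v (fun w hwS hw4 => hv w ((hmemW w).2 ⟨hwS, hw4⟩))
    linarith) hcol hfix v
  rw [hBB] at hdef
  have : ((e₄ - 4 * μ : ℝ)) * (star v ⬝ᵥ v).re = (e₄ - 4 * μ) * (star v ⬝ᵥ v).re := rfl
  linarith


/-! ### The parent keeps almost every plaquette in its singlet: the diagonal Gram bound -/

set_option maxHeartbeats 1600000 in
/-- **Diagonal Gram bound, unit form.** For a unit ground state `Ω` of the parent sector `(L², 0)` of
the breathing torus `H_L(1, b, U)` (`L` even, `L ≥ 4`, `L² = 2p`) and the rank-one defect form of the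
plaquette (`σ` the unit `(4,0)` plaquette ground state, constants `μ`, `γ > 0`):
`Σ_c Re⟨Ω, (f_c)_*|σ⟩⟨σ| Ω⟩ ≥ L²/4 − 16 b L²/γ` — all but `O(bL²/γ)` plaquettes of the dressed parent
are in their singlet ground state (best-plaquette averaging of the pair ceiling, summed instead of
pigeonholed). [folklore] -/
theorem sum_re_localVacuum_ge_of_unit {L : ℕ} [NeZero L] (hL : Even L) (U μ γ b : ℝ)
    (hγ : 0 < γ) (hb0 : 0 < b)
    {σ : Fock (Orb (FermionTorus 2 2))} (hσ1 : star σ ⬝ᵥ σ = 1) (hσS : σ ∈ szSector (Λ := FermionTorus 2 2) 4 0)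
    (hσE : hubbardTorus 2 2 1 U *ᵥ σ = (((hubbardTorus 2 2 1 U).minEnergyOn (szSector 4 0) : ℝ) : ℂ) • σ)
    (hdefect : ∀ v : Fock (Orb (FermionTorus 2 2)),
      γ * ((star v ⬝ᵥ v).re - (star v ⬝ᵥ (vecMulVec σ (star σ) *ᵥ v)).re) ≤
        (star v ⬝ᵥ ((hubbardTorus 2 2 1 U - (μ : ℂ) • totalNumber) *ᵥ v)).re -
          ((hubbardTorus 2 2 1 U).minEnergyOn (szSector 4 0) - 4 * μ) * (star v ⬝ᵥ v).re)
    {f : ℕ × ℕ → (FermionTorus 2 2 ↪o FermionTorus 2 L)}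
    (hf : ∀ c ∈ Finset.range (L / 2) ×ˢ Finset.range (L / 2), ∀ X j,
      (ofLex (f c X) j : ℕ) = ![c.1 * 2, c.2 * 2] j + (ofLex X j : ℕ))
    {p : ℕ} (hp : L ^ 2 = 2 * p) {Ω : Fock (Orb (FermionTorus 2 L))} (hΩ1 : star Ω ⬝ᵥ Ω = 1)
    (hΩ : IsGroundStateInSector
      (hamiltonian (fermionTorusGraph 2 L \ (⊤ : SimpleGraph (Fin 2 → ℕ)).comap
          (fun (x : FermionTorus 2 L) (i : Fin 2) => (ofLex x i : ℕ) / 2)) 1 U +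
        hamiltonian (fermionTorusGraph 2 L ⊓ (⊤ : SimpleGraph (Fin 2 → ℕ)).comap
          (fun (x : FermionTorus 2 L) (i : Fin 2) => (ofLex x i : ℕ) / 2)) b 0) (2 * p) 0 Ω) :
    (L : ℝ) ^ 2 / 4 - 16 * b * (L : ℝ) ^ 2 / γ ≤
      ∑ c ∈ Finset.range (L / 2) ×ˢ Finset.range (L / 2),
        (star Ω ⬝ᵥ (jwEmbed (orbEmb (f c)) (vecMulVec σ (star σ)) *ᵥ Ω)).re := by
  classical
  -- notation
  set h := hubbardTorus 2 2 1 U with hh_def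
  set e₄ : ℝ := h.minEnergyOn (szSector 4 0) with he₄
  set Gin := fermionTorusGraph 2 L \ (⊤ : SimpleGraph (Fin 2 → ℕ)).comap
    (fun (x : FermionTorus 2 L) (i : Fin 2) => (ofLex x i : ℕ) / 2) with hGin
  set Gout := fermionTorusGraph 2 L ⊓ (⊤ : SimpleGraph (Fin 2 → ℕ)).comap
    (fun (x : FermionTorus 2 L) (i : Fin 2) => (ofLex x i : ℕ) / 2) with hGout
  set Hin := hamiltonian Gin 1 U with hHin
  set Tm := hamiltonian Gout 1 0 with hTm
  set Hb := hamiltonian Gin 1 U + hamiltonian Gout b 0 with hHb_def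
  have hHbT : Hb = Hin + (b : ℂ) • Tm := by rw [hHb_def, hamiltonian_zero_interaction Gout b]
  have hHb : Hb.IsHermitian := breathing_isHermitian Gin Gout 1 b U
  have hGout_le : Gout ≤ fermionTorusGraph 2 L := inf_le_left
  -- arithmetic of `L`
  have hcardΛ : Fintype.card (FermionTorus 2 L) = 2 * p := by
    rw [Summit.HubbardSuperconductivity.NoGo.card_fermionTorus_two, hp]
  -- the plaquette blocks
  set T := Finset.range (L / 2) ×ˢ Finset.range (L / 2) with hT
  have hTcard : (T.card : ℝ) * 4 = 2 * p := by
    have h1 : T.card = (L / 2) ^ 2 := card_blocks_half L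
    have h2 : (L / 2) * 2 = L := Nat.div_mul_cancel (even_iff_two_dvd.1 hL)
    have h3 : (T.card : ℕ) * 4 = 2 * p := by rw [h1, ← hp]; nlinarith [h2]
    exact_mod_cast h3
  have hL2R : (L : ℝ) ^ 2 = T.card * 4 := by
    rw [hTcard]
    exact_mod_cast hp
  have hdisjR : ∀ c ∈ T, ∀ c' ∈ T, c ≠ c' →
      Disjoint ((Finset.univ : Finset (FermionTorus 2 2)).map (f c).toEmbedding)
        ((Finset.univ : Finset (FermionTorus 2 2)).map (f c').toEmbedding) :=
    disjoint_map_of_ne_range T f (FermionTorus.blockFamily_ne (M := 2) (by norm_num) hf) (fun _ => Finset.univ)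
  have hcover := biUnion_range_blockFamily_eq_univ hf hL
  -- decomposition of the intra part
  have hdec : Hin = ∑ c ∈ T, jwEmbed (orbEmb (f c)) h := hamiltonian_intra_eq_sum_jwEmbed hL U hf
  -- the ground state `Ω` of the parent sector
  obtain ⟨hΩS, hΩ0, hHbΩ⟩ := hΩ
  set E : ℝ := Hb.minEnergyOn (szSector (2 * p) 0) with hE
  have hNΩ : totalNumber *ᵥ Ω = ((2 * p : ℕ) : ℂ) • Ω :=
    (LiebTwo.isNParticle_iff_totalNumber _ Ω).1 ((mem_szSector_iff _ 0 Ω).1 hΩS).1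
  -- hopping form bound
  have hTform : ∀ ψ : Fock (Orb (FermionTorus 2 L)),
      |(star ψ ⬝ᵥ (Tm *ᵥ ψ)).re| ≤ 8 * (L : ℝ) ^ 2 * (star ψ ⬝ᵥ ψ).re := by
    intro ψ
    have := abs_re_hopping_le_torus hGout_le 1 ψ
    simpa using this
  -- energy of `Ω`
  have hEΩ : (star Ω ⬝ᵥ (Hb *ᵥ Ω)).re = E := by
    rw [hHbΩ, dotProduct_smul, hΩ1, smul_eq_mul, mul_one, Complex.ofReal_re]
  have hHinΩ : (star Ω ⬝ᵥ (Hin *ᵥ Ω)).re ≤ E + b * (8 * (L : ℝ) ^ 2) := by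
    have h1 : (star Ω ⬝ᵥ (Hin *ᵥ Ω)).re = E - b * (star Ω ⬝ᵥ (Tm *ᵥ Ω)).re := by
      rw [← hEΩ, hHbT, add_mulVec, smul_mulVec, dotProduct_add, dotProduct_smul, smul_eq_mul,
        Complex.add_re, Complex.re_ofReal_mul]
      ring
    have h2 := hTform Ω
    rw [hΩ1, Complex.one_re, mul_one] at h2
    rw [h1]
    nlinarith [abs_le.1 h2]
  -- the block product vector gives the upper bound `E ≤ |T| e₄ + 8 b L²`
  have hEup : E ≤ T.card * e₄ + b * (8 * (L : ℝ) ^ 2) := by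
    obtain ⟨Ω₀, hΩ₀0, hΩ₀eig⟩ := exists_blockProduct_vector T f hdisjR hσ1
    have hN4 : totalNumber *ᵥ σ = ((4 : ℕ) : ℂ) • σ :=
      (LiebTwo.isNParticle_iff_totalNumber 4 σ).1 ((mem_szSector_iff 4 0 σ).1 hσS).1
    have hSz0 : HubbardWave0.spinZ *ᵥ σ = (0 : ℂ) • σ := by
      have := ((mem_szSector_iff 4 0 σ).1 hσS).2
      rwa [Complex.ofReal_zero] at this
    have hHinΩ₀ : Hin *ᵥ Ω₀ = ((T.card : ℂ) * (e₄ : ℂ)) • Ω₀ := by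
      rw [hdec]
      exact hΩ₀eig h _ (hubbardTorus_two_mem_carEvenSubalgebra U) hσE
    have hNΩ₀ : totalNumber *ᵥ Ω₀ = ((T.card : ℂ) * ((4 : ℕ) : ℂ)) • Ω₀ := by
      rw [← sum_jwEmbed_totalNumber_eq hL hf]
      exact hΩ₀eig _ _ totalNumber_mem_carEvenSubalgebra hN4
    have hSzΩ₀ : HubbardWave0.spinZ *ᵥ Ω₀ = ((T.card : ℂ) * 0) • Ω₀ := by
      rw [← sum_jwEmbed_spinZ_eq_of_cover T f hdisjR (by convert hcover)]
      exact hΩ₀eig _ _ spinZ_mem_carEvenSubalgebra hSz0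
    have hΩ₀S : Ω₀ ∈ szSector (Λ := FermionTorus 2 L) (2 * p) 0 := by
      rw [mem_szSector_iff]
      constructor
      · rw [LiebTwo.isNParticle_iff_totalNumber, hNΩ₀]
        congr 1
        have : ((T.card : ℕ) : ℂ) * 4 = ((2 * p : ℕ) : ℂ) := by exact_mod_cast (show (T.card : ℝ) * 4 = 2 * p from hTcard)
        push_cast at this ⊢
        exact this
      · rw [hSzΩ₀, mul_zero, Complex.ofReal_zero]
    have hvar := minEnergyOn_szSector_mul_le Hb hHb hΩ₀S
    have hpos : 0 < (star Ω₀ ⬝ᵥ Ω₀).re := (Complex.pos_iff.1 (dotProduct_star_self_pos_iff.2 hΩ₀0)).1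
    have hval : (star Ω₀ ⬝ᵥ (Hb *ᵥ Ω₀)).re ≤ (T.card * e₄ + b * (8 * (L : ℝ) ^ 2)) * (star Ω₀ ⬝ᵥ Ω₀).re := by
      rw [hHbT, add_mulVec, smul_mulVec, dotProduct_add, dotProduct_smul, smul_eq_mul, Complex.add_re,
        Complex.re_ofReal_mul, hHinΩ₀, dotProduct_smul, smul_eq_mul]
      have h2 := hTform Ω₀
      have h3 : (((T.card : ℂ) * (e₄ : ℂ)) * (star Ω₀ ⬝ᵥ Ω₀)).re = T.card * e₄ * (star Ω₀ ⬝ᵥ Ω₀).re := by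
        rw [star_dotProduct_self_eq_re Ω₀]
        simp only [Complex.mul_re, Complex.natCast_re, Complex.natCast_im, Complex.ofReal_re, Complex.ofReal_im,
          mul_zero, sub_zero]
      rw [h3]
      nlinarith [abs_le.1 h2, hpos.le]
    rw [← hE] at hvar
    exact le_of_mul_le_mul_right (hvar.trans hval) hpos
  -- the local defects, transported to every block
  set g : ℝ := e₄ - 4 * μ with hg
  have hq : (h - (μ : ℂ) • totalNumber).IsHermitian := by
    have := isHermitian_hamiltonianWith plaquetteGraph 1 U μ
    rwa [hamiltonianWith_eq] at this
  have hPherm : (vecMulVec σ (star σ)).IsHermitian := isHermitian_vecMulVec_self σ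
  set Q : ℕ × ℕ → Matrix (Finset (Orb (FermionTorus 2 L))) (Finset (Orb (FermionTorus 2 L))) ℂ :=
    fun c => jwEmbed (orbEmb (f c)) (h - (μ : ℂ) • totalNumber) - (g : ℂ) • 1 with hQ
  set P : ℕ × ℕ → Matrix (Finset (Orb (FermionTorus 2 L))) (Finset (Orb (FermionTorus 2 L))) ℂ :=
    fun c => jwEmbed (orbEmb (f c)) (vecMulVec σ (star σ)) with hP
  have hQP : ∀ c ∈ T, ∀ V : Fock (Orb (FermionTorus 2 L)),
      γ * ((star V ⬝ᵥ V).re - (star V ⬝ᵥ (P c *ᵥ V)).re) ≤ (star V ⬝ᵥ (Q c *ᵥ V)).re := by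
    intro c _ V
    have h1 := re_form_defect_jwEmbed (orbEmb (f c)) hq hPherm hdefect V
    have h2 : (star V ⬝ᵥ (Q c *ᵥ V)).re =
        (star V ⬝ᵥ (jwEmbed (orbEmb (f c)) (h - (μ : ℂ) • totalNumber) *ᵥ V)).re - g * (star V ⬝ᵥ V).re := by
      rw [hQ]
      dsimp only
      rw [sub_mulVec, smul_mulVec, one_mulVec, dotProduct_sub, dotProduct_smul, smul_eq_mul, Complex.sub_re,
        Complex.re_ofReal_mul]
    rw [h2]
    exact h1
  -- the value of `Σ_c Q_c` on `Ω`
  have hX : ∀ c, jwEmbed (orbEmb (f c)) (h - (μ : ℂ) • totalNumber) =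
      jwEmbed (orbEmb (f c)) h - (μ : ℂ) • jwEmbed (orbEmb (f c)) (totalNumber : Matrix _ _ ℂ) := by
    intro c
    rw [jwEmbed_sub', jwEmbed_smul']
  have hsumQ : (∑ c ∈ T, Q c) *ᵥ Ω =
      Hin *ᵥ Ω - ((μ : ℂ) * ((2 * p : ℕ) : ℂ) + (T.card : ℂ) * (g : ℂ)) • Ω := by
    have h1 : ∑ c ∈ T, Q c = (∑ c ∈ T, jwEmbed (orbEmb (f c)) h) -
        (μ : ℂ) • (∑ c ∈ T, jwEmbed (orbEmb (f c)) (totalNumber : Matrix _ _ ℂ)) -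
          ∑ c ∈ T, (g : ℂ) • (1 : Matrix (Finset (Orb (FermionTorus 2 L))) (Finset (Orb (FermionTorus 2 L))) ℂ) := by
      rw [hQ]
      dsimp only
      rw [Finset.sum_sub_distrib, Finset.sum_congr rfl fun c _ => hX c, Finset.sum_sub_distrib, ← Finset.smul_sum]
    rw [h1, ← hdec, sum_jwEmbed_totalNumber_eq hL hf, Finset.sum_const, ← Nat.cast_smul_eq_nsmul ℂ, smul_smul,
      sub_mulVec, sub_mulVec, smul_mulVec, smul_mulVec, one_mulVec, hNΩ, smul_smul, sub_sub, ← add_smul]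
  have hBd : (star Ω ⬝ᵥ ((∑ c ∈ T, Q c) *ᵥ Ω)).re ≤ 16 * b * (L : ℝ) ^ 2 := by
    rw [hsumQ, dotProduct_sub, dotProduct_smul, hΩ1, smul_eq_mul, mul_one, Complex.sub_re]
    have hreal : (μ : ℂ) * ((2 * p : ℕ) : ℂ) + (T.card : ℂ) * (g : ℂ) = ((μ * (2 * p) + T.card * g : ℝ) : ℂ) := by
      push_cast
      ring
    rw [hreal, Complex.ofReal_re]
    have hμ : μ * (2 * (p : ℝ)) = 4 * μ * T.card := by rw [← hTcard]; ring
    have hkey : μ * (2 * (p : ℝ)) + T.card * g = T.card * e₄ := by rw [hμ, hg]; ring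
    rw [hkey]
    linarith [hHinΩ, hEup]
  -- summing the local defects
  have hsum := sum_defect_le_of_forms T Q P hγ hQP Ω
  rw [hΩ1, Complex.one_re] at hsum
  have hsum' : ∑ c ∈ T, (1 - (star Ω ⬝ᵥ (P c *ᵥ Ω)).re) ≤ 16 * b * (L : ℝ) ^ 2 / γ :=
    hsum.trans (div_le_div_of_nonneg_right hBd hγ.le)
  rw [Finset.sum_sub_distrib, Finset.sum_const, nsmul_eq_mul, mul_one] at hsum'
  have hT4 : (T.card : ℝ) = (L : ℝ) ^ 2 / 4 := by rw [hL2R]; ring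
  rw [hT4] at hsum'
  have : ∑ c ∈ T, (star Ω ⬝ᵥ (P c *ᵥ Ω)).re =
      ∑ c ∈ T, (star Ω ⬝ᵥ (jwEmbed (orbEmb (f c)) (vecMulVec σ (star σ)) *ᵥ Ω)).re := rfl
  linarith


/-- `Re⟨cψ, P cψ⟩ = |c|² Re⟨ψ, Pψ⟩`. [folklore] -/
theorem re_star_smul_dotProduct_mulVec_smul {n : Type*} [Fintype n] (P : Matrix n n ℂ) (c : ℂ) (ψ : n → ℂ) :
    (star (c • ψ) ⬝ᵥ (P *ᵥ (c • ψ))).re = ‖c‖ ^ 2 * (star ψ ⬝ᵥ (P *ᵥ ψ)).re := by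
  rw [mulVec_smul, star_smul, smul_dotProduct, dotProduct_smul, smul_smul, smul_eq_mul, Complex.star_def,
    Complex.conj_mul', ← Complex.ofReal_pow, Complex.re_ofReal_mul]

/-- **Diagonal Gram bound** (homogeneous form): for every ground state `Ω` of the parent sector
`(L², 0)` of `H_L(1, b, U)`, `(L²/4 − 16bL²/γ)‖Ω‖² ≤ Σ_c Re⟨Ω, (f_c)_*|σ⟩⟨σ| Ω⟩`. [folklore] -/
theorem sum_re_localVacuum_ge {L : ℕ} [NeZero L] (hL : Even L) (U μ γ b : ℝ)
    (hγ : 0 < γ) (hb0 : 0 < b)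
    {σ : Fock (Orb (FermionTorus 2 2))} (hσ1 : star σ ⬝ᵥ σ = 1) (hσS : σ ∈ szSector (Λ := FermionTorus 2 2) 4 0)
    (hσE : hubbardTorus 2 2 1 U *ᵥ σ = (((hubbardTorus 2 2 1 U).minEnergyOn (szSector 4 0) : ℝ) : ℂ) • σ)
    (hdefect : ∀ v : Fock (Orb (FermionTorus 2 2)),
      γ * ((star v ⬝ᵥ v).re - (star v ⬝ᵥ (vecMulVec σ (star σ) *ᵥ v)).re) ≤
        (star v ⬝ᵥ ((hubbardTorus 2 2 1 U - (μ : ℂ) • totalNumber) *ᵥ v)).re -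
          ((hubbardTorus 2 2 1 U).minEnergyOn (szSector 4 0) - 4 * μ) * (star v ⬝ᵥ v).re)
    {f : ℕ × ℕ → (FermionTorus 2 2 ↪o FermionTorus 2 L)}
    (hf : ∀ c ∈ Finset.range (L / 2) ×ˢ Finset.range (L / 2), ∀ X j,
      (ofLex (f c X) j : ℕ) = ![c.1 * 2, c.2 * 2] j + (ofLex X j : ℕ))
    {p : ℕ} (hp : L ^ 2 = 2 * p) {Ω : Fock (Orb (FermionTorus 2 L))}
    (hΩ : IsGroundStateInSector
      (hamiltonian (fermionTorusGraph 2 L \ (⊤ : SimpleGraph (Fin 2 → ℕ)).comap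
          (fun (x : FermionTorus 2 L) (i : Fin 2) => (ofLex x i : ℕ) / 2)) 1 U +
        hamiltonian (fermionTorusGraph 2 L ⊓ (⊤ : SimpleGraph (Fin 2 → ℕ)).comap
          (fun (x : FermionTorus 2 L) (i : Fin 2) => (ofLex x i : ℕ) / 2)) b 0) (2 * p) 0 Ω) :
    ((L : ℝ) ^ 2 / 4 - 16 * b * (L : ℝ) ^ 2 / γ) * (star Ω ⬝ᵥ Ω).re ≤
      ∑ c ∈ Finset.range (L / 2) ×ˢ Finset.range (L / 2),
        (star Ω ⬝ᵥ (jwEmbed (orbEmb (f c)) (vecMulVec σ (star σ)) *ᵥ Ω)).re := by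
  obtain ⟨hΩS, hΩ0, hHbΩ⟩ := hΩ
  obtain ⟨c, hc0, hc1⟩ := exists_smul_unit hΩ0
  have hΩ' : IsGroundStateInSector
      (hamiltonian (fermionTorusGraph 2 L \ (⊤ : SimpleGraph (Fin 2 → ℕ)).comap
          (fun (x : FermionTorus 2 L) (i : Fin 2) => (ofLex x i : ℕ) / 2)) 1 U +
        hamiltonian (fermionTorusGraph 2 L ⊓ (⊤ : SimpleGraph (Fin 2 → ℕ)).comap
          (fun (x : FermionTorus 2 L) (i : Fin 2) => (ofLex x i : ℕ) / 2)) b 0) (2 * p) 0 (c • Ω) :=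
    ⟨Submodule.smul_mem _ c hΩS, smul_ne_zero hc0 hΩ0, by rw [mulVec_smul, hHbΩ, smul_comm]⟩
  have h1 := sum_re_localVacuum_ge_of_unit hL U μ γ b hγ hb0 hσ1 hσS hσE hdefect hf hp hc1 hΩ'
  rw [Finset.sum_congr rfl fun c' _ => re_star_smul_dotProduct_mulVec_smul _ c Ω, ← Finset.mul_sum] at h1
  have hnorm : ‖c‖ ^ 2 * (star Ω ⬝ᵥ Ω).re = 1 := by
    have h2 := re_star_smul_dotProduct_mulVec_smul (1 : Matrix _ _ ℂ) c Ω
    rw [one_mulVec, one_mulVec, hc1, Complex.one_re] at h2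
    exact h2.symm
  have hΩpos : 0 ≤ (star Ω ⬝ᵥ Ω).re := (Complex.nonneg_iff.1 (dotProduct_star_self_nonneg Ω)).1
  calc ((L : ℝ) ^ 2 / 4 - 16 * b * (L : ℝ) ^ 2 / γ) * (star Ω ⬝ᵥ Ω).re
      ≤ (‖c‖ ^ 2 * ∑ c' ∈ Finset.range (L / 2) ×ˢ Finset.range (L / 2),
          (star Ω ⬝ᵥ (jwEmbed (orbEmb (f c')) (vecMulVec σ (star σ)) *ᵥ Ω)).re) * (star Ω ⬝ᵥ Ω).re :=
        mul_le_mul_of_nonneg_right h1 hΩpos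
    _ = _ := by
        rw [mul_comm (‖c‖ ^ 2), mul_assoc, hnorm, mul_one]


/-! ### Registered form -/

/-- **Registered sub-goal `dWaveResidue_diagonalGram`** (closed form, as registered on the crux item):
the diagonal Gram bound of the dressed parent from the rank-one plaquette defect form. [folklore] -/
theorem dWaveResidue_diagonalGram : ∀ {L : ℕ} [NeZero L], Even L → ∀ (U μ γ b : ℝ), 0 < γ → 0 < b → ∀ {σ : Fock (Orb (FermionTorus 2 2))}, star σ ⬝ᵥ σ = 1 → σ ∈ szSector (Λ := FermionTorus 2 2) 4 0 → hubbardTorus 2 2 1 U *ᵥ σ = (((hubbardTorus 2 2 1 U).minEnergyOn (szSector 4 0) : ℝ) : ℂ) • σ → (∀ v : Fock (Orb (FermionTorus 2 2)), γ * ((star v ⬝ᵥ v).re - (star v ⬝ᵥ (vecMulVec σ (star σ) *ᵥ v)).re) ≤ (star v ⬝ᵥ ((hubbardTorus 2 2 1 U - (μ : ℂ) • totalNumber) *ᵥ v)).re - ((hubbardTorus 2 2 1 U).minEnergyOn (szSector 4 0) - 4 * μ) * (star v ⬝ᵥ v).re) → ∀ {f : ℕ × ℕ → (FermionTorus 2 2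 ↪o FermionTorus 2 L)}, (∀ c ∈ Finset.range (L / 2) ×ˢ Finset.range (L / 2), ∀ X j, (ofLex (f c X) j : ℕ) = ![c.1 * 2, c.2 * 2] j + (ofLex X j : ℕ)) → ∀ {p : ℕ}, L ^ 2 = 2 * p → ∀ {Ω : Fock (Orb (FermionTorus 2 L))}, IsGroundStateInSector (hamiltonian (fermionTorusGraph 2 L \ (⊤ : SimpleGraph (Fin 2 → ℕ)).comap (fun (x : FermionTorus 2 L) (i : Fin 2) => (ofLex x i : ℕ) / 2)) 1 U + hamiltonian (fermionTorusGraph 2 L ⊓ (⊤ : SimpleGraph (Fin 2 → ℕ)).comap (fun (x : FermionTorus 2 L) (i : Fin 2) => (ofLex x i : ℕ) / 2)) b 0) (2 * p) 0 Ω → ((L : ℝ) ^ 2 / 4 - 16 * b * (L : ℝ) ^ 2 / γ) * (star Ω ⬝ᵥ Ω).re ≤ ∑ c ∈ Finset.range (L / 2) ×ˢ Finset.range (L / 2), (star Ω ⬝ᵥ (jwEmbed (orbEmb (f c)) (vecMulVec σ (star σ)) *ᵥ Ω)).re := by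
  intro L _ hL U μ γ b hγ hb0 σ hσ1 hσS hσE hdef f hf p hp Ω hΩ
  exact sum_re_localVacuum_ge hL U μ γ b hγ hb0 hσ1 hσS hσE hdef hf hp hΩ

end Summit.HubbardSuperconductivity.HubbardSuperconductivity.Theorems.CooperPairDMottWalk

end
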